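import Literature.AlgebraicGeometry.Frobenioids.DivisorMonoidBirationalTypesProofs
import Literature.AlgebraicGeometry.Frobenioids.Composites
import HarnessLib

/-!
# Frobenioids I, Proposition 4.8 (ii): the birationalization of a Frobenioid of perfect and isotropic
# type is of perfect and isotropic type — PROVED for THE birationalization

Mochizuki, *The geometry of Frobenioids I: the general theory*, Kyushu J. Math. **62** (2008)
293–400, §4, Proposition 4.8 (ii), kurims text p. 88 [cite: MochizukiFrdI2008, Prop. 4.8 (ii) p.88]:
"(ii) If `C` is of perfect and isotropic type, then so is `C^birat`."

PROOF-ONLY companion (theorems only, no new definitions) of seat abc-iut-L1-t3's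
`DivisorMonoidCategoryTheoreticityDefs.lean` (`PreFrobenioidData.Prop48ii S B`, typed over a
birationalization datum `B : S.BiratData`), proved here for THE birationalization
`C^birat = PreFrobenioid.Birat F hF hsq` with its pre-Frobenioid structure
`Birat.toElemZero hF hsq : C^birat ⥤ F_{0_D}` (seats abc-iut-L6-t8 / abc-iut-L6-t6), continuing
`DivisorMonoidBirationalTypesProofs.lean` (Prop. 4.8 (i)).

The printed proof deduces perfection of `C^birat` from the naive Frobenius functor of Prop. 2.1 and
its criterion Prop. 2.1 (iii). Here "perfect" is proved DIRECTLY in the form of Def. 1.2 (iv) (found's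
`PreFrobenioid.IsPerfectObj`: (a) morphisms of Frobenius type of every degree into every base-isomorphic
object; (b) unique lifting of pre-steps along pairs of morphisms of Frobenius type of equal degree),
from the same ingredients the printed argument rests on: Prop. 4.4 (ii) (`C → C^birat` faithful),
Prop. 4.4 (iv) (co-angular pre-steps become isomorphisms; degrees and bases are preserved), Prop. 4.8 (i)
(every pre-step of `C^birat` is an isomorphism, every morphism co-angular), Prop. 1.7 (ii)
(base-isomorphism = Frobenius type ∘ pre-step, `isBaseIso_iff_exists_frobeniusType_preStep`) and the
perfection of `C` itself:

* `Birat.isFrobeniusType_iff_isBaseIso` — in `C^birat` (for `C` of isotropic type) "Frobenius type" =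
  "base-isomorphism";
* `Birat.exists_lift_iso` — lifting an isomorphism `θ′ : E₁^birat ⥲ E₂^birat` along the images of two
  morphisms `γᵢ : Pᵢ → Eᵢ` of Frobenius type of the same degree (perfection (b) of `C` applied twice
  through an auxiliary morphism of Frobenius type `γ° : P° → E°` into the apex of `θ′ = ε⁻¹ ∘ g`);
* `Birat.eq_of_comp_toBirat_map_eq` — two isomorphisms `u, v : W ⥲ P^birat` with `u ≫ γ^birat =
  v ≫ γ^birat`, `γ` of Frobenius type, coincide (faithfulness + uniqueness half of perfection (b));
* `Birat.isPerfectObj`, **`Birat.isOfPerfectType`** — Prop. 4.8 (ii) for `C^birat ⥤ F_{0_D}`; and the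
  §4-interface form `PreFrobenioidData.isOfPerfectType_ofFunctor_toElemZero` /
  `PreFrobenioidData.prop48ii_body_toElemZero` (literally the body of `Prop48ii` at the operations
  `ofFunctor 0_D (Birat.toElemZero hF hsq)` of THE birationalization).

ERRATUM NOTE: the author's "Comments on [FrdI]" (Jan. 2024), item (29)(iii), replace "of perfect and
isotropic type" by "of perfect, isotropic, and birationally Frobenius-normalized type" in Prop. 4.8 (ii)
(hypothesis and conclusion) — the extra hypothesis is what the amended Prop. 4.4 (ii) needs to make
`C^birat` a FROBENIOID, through which the printed proof (Prop. 2.1 (iii)) passes. The direct argument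
here establishes perfection of the PRE-Frobenioid structure `C^birat → F_{0_D}` (Def. 1.2 (iv)) from the
2008 hypotheses alone and never uses that `C^birat` is a Frobenioid; so the 2008 statement, as typed by
abc-iut-L1-t3, is what is proved.

Node `FrdI:Prop4.8(ii)` (abc-iut cell, seat abc-iut-L6-t20). No statement of the paper is strengthened;
nothing here concerns the disputed parts of IUT.
-/

namespace Literature.AlgebraicGeometry.Frobenioids

open CategoryTheory Opposite

universe w v v' u u'

namespace PreFrobenioid

variable {D : Type u} [Category.{v} D] {Φ : Dᵒᵖ ⥤ CommMonCat.{w}}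
  {C : Type u'} [Category.{v'} C] {F : C ⥤ ElemFrobenioid Φ}
  {hF : IsFrobenioid F} {hsq : HasBiratSquares F}

namespace Birat

/-! ### Bookkeeping: fractions over objects of `C`, bases and degrees along `C → C^birat` -/

/-- Every morphism `A^birat ⇢ B^birat` is the class of a fraction `(α, φ′)` from `A` to `B`.
[cite: MochizukiFrdI2008, Prop. 4.4 (i) p.83] -/
theorem exists_homMk_eq {A B : C} (φ : (toBirat F hF hsq).obj A ⟶ (toBirat F hF hsq).obj B) :
    ∃ f : BiratFrac F A B,
      (homMk f : (toBirat F hF hsq).obj A ⟶ (toBirat F hF hsq).obj B) = φ :=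
  homMk_surjective φ

/-- `deg_Fr` is preserved by `C → C^birat` (Prop. 4.4 (iv)). [cite: MochizukiFrdI2008, Prop. 4.4 (iv) p.83] -/
theorem degFr_toElemZero_map {A B : C} (φ : A ⟶ B) :
    degFr (toElemZero hF hsq) ((toBirat F hF hsq).map φ) = degFr F φ := rfl

/-- `Base` is preserved by `C → C^birat` (Prop. 4.4 (i)). [cite: MochizukiFrdI2008, Prop. 4.4 (i) p.83] -/
theorem base_toElemZero_map {A B : C} (φ : A ⟶ B) :
    Base (toElemZero hF hsq) ((toBirat F hF hsq).map φ) = Base F φ :=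
  BiratFrac.base_ofHom hF φ

/-- Base-isomorphisms of `C` map to base-isomorphisms of `C^birat` (Prop. 4.4 (iv)).
[cite: MochizukiFrdI2008, Prop. 4.4 (iv) p.83] -/
theorem isBaseIso_toElemZero_map {A B : C} {φ : A ⟶ B} (h : IsBaseIso F φ) :
    IsBaseIso (toElemZero hF hsq) ((toBirat F hF hsq).map φ) := by
  change IsIso (Base (toElemZero hF hsq) ((toBirat F hF hsq).map φ))
  rw [base_toElemZero_map]
  exact h

/-- If the class `[(α, φ′)]` is a base-isomorphism of `C^birat`, then `φ′` is a base-isomorphism of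
`C` (`Base(φ′) = Base(α) ≫ Base([(α, φ′)])`). [cite: MochizukiFrdI2008, Prop. 4.4 (iv) p.83] -/
theorem isBaseIso_num {A B : C} (f : BiratFrac F A B)
    (h : IsBaseIso (toElemZero hF hsq)
      (homMk f : (toBirat F hF hsq).obj A ⟶ (toBirat F hF hsq).obj B)) :
    IsBaseIso F f.num := by
  haveI : IsIso (Base F f.den) := f.den_mem.2.2
  have hb : IsIso (BiratFrac.base f) := h
  have he : Base F f.num = Base F f.den ≫ BiratFrac.base f := by
    unfold BiratFrac.base
    rw [IsIso.hom_inv_id_assoc]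
  change IsIso (Base F f.num)
  rw [he]
  infer_instance

/-- `deg_Fr([(α, φ′)]) = deg_Fr(φ′)`. [cite: MochizukiFrdI2008, Prop. 4.4 (iv) p.83] -/
theorem degFr_toElemZero_homMk' {A B : C} (f : BiratFrac F A B) :
    degFr (toElemZero hF hsq) (homMk f : (toBirat F hF hsq).obj A ⟶ (toBirat F hF hsq).obj B) =
      degFr F f.num := rfl

/-! ### Prop. 4.8 (i) consequences: co-angularity and Frobenius type in `C^birat` -/

/-- For `C` of isotropic type every morphism of `C^birat` is co-angular (every object of `C^birat` is
isotropic, Prop. 4.8 (i); Prop. 1.4 (i)). [cite: MochizukiFrdI2008, Prop. 4.8 (i) p.88] -/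
theorem isCoAngular (hiso : IsOfIsotropicType F) {X Y : Birat F hF hsq} (ψ : X ⟶ Y) :
    IsCoAngular (toElemZero hF hsq) ψ :=
  isCoAngular_of_isIsotropic_codomains (toElemZero hF hsq) ψ fun W _ => isIsotropic hiso W

/-- For `C` of isotropic type a morphism of `C^birat` is of Frobenius type iff it is a
base-isomorphism (all morphisms being co-angular isometries). [cite: MochizukiFrdI2008, Prop. 4.8 (i) p.88] -/
theorem isFrobeniusType_iff_isBaseIso (hiso : IsOfIsotropicType F) {X Y : Birat F hF hsq}
    (ψ : X ⟶ Y) : IsFrobeniusType (toElemZero hF hsq) ψ ↔ IsBaseIso (toElemZero hF hsq) ψ :=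
  ⟨fun h => h.2, fun h => ⟨⟨isCoAngular hiso ψ, isIsometry_toElemZero ψ⟩, h⟩⟩

/-- For `C` of isotropic type an isomorphism of `C^birat` is a pre-step, and conversely
(Prop. 4.8 (i)). [cite: MochizukiFrdI2008, Prop. 4.8 (i) p.88] -/
theorem isPreStep_iff_isIso (hiso : IsOfIsotropicType F) {X Y : Birat F hF hsq} (ψ : X ⟶ Y) :
    IsPreStep (toElemZero hF hsq) ψ ↔ IsIso ψ :=
  ⟨isIso_of_isPreStep hiso ψ, fun _ => isPreStep_of_isIso (toElemZero hF hsq) ψ⟩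

/-! ### The two key lemmas -/

/-- **Lifting isomorphisms along morphisms of Frobenius type of equal degree.** For `C` a Frobenioid of
perfect and isotropic type, `γᵢ : Pᵢ → Eᵢ` (`i = 1, 2`) of Frobenius type of the same degree `n` and an
isomorphism `θ′ : E₁^birat ⥲ E₂^birat`, there is an isomorphism `θ : P₁^birat ⥲ P₂^birat` with
`θ ≫ γ₂^birat = γ₁^birat ≫ θ′`.  Proof: `θ′ = ε⁻¹ ∘ g` with `ε : E° → E₁` a co-angular pre-step and
`g : E° → E₂` a pre-step (Prop. 4.4 (iv)); choose `γ° : P° → E°` of Frobenius type of degree `n`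
(perfection (a)); lift `ε`, `g` along `(γ°, γ₁)`, `(γ°, γ₂)` to pre-steps `ε̃ : P° → P₁`, `g̃ : P° → P₂`
(perfection (b)); these are co-angular (isotropic type), so invertible in `C^birat`, and
`θ := ε̃⁻¹ ∘ g̃`. [cite: MochizukiFrdI2008, Prop. 4.8 (ii) p.88] -/
theorem exists_lift_iso (hperf : IsOfPerfectType F) (hiso : IsOfIsotropicType F) {n : ℕ+}
    {P₁ E₁ P₂ E₂ : C} (γ₁ : P₁ ⟶ E₁) (γ₂ : P₂ ⟶ E₂) (hγ₁ : IsFrobeniusType F γ₁)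
    (hd₁ : degFr F γ₁ = n) (hγ₂ : IsFrobeniusType F γ₂) (hd₂ : degFr F γ₂ = n)
    (θ' : (toBirat F hF hsq).obj E₁ ⟶ (toBirat F hF hsq).obj E₂) [IsIso θ'] :
    ∃ (θ : (toBirat F hF hsq).obj P₁ ⟶ (toBirat F hF hsq).obj P₂), IsIso θ ∧
      θ ≫ (toBirat F hF hsq).map γ₂ = (toBirat F hF hsq).map γ₁ ≫ θ' := by
  obtain ⟨f, hf⟩ := exists_homMk_eq θ'
  -- `θ′ = [(ε, g)]`, `ε : E° → E₁` a co-angular pre-step, `g : E° → E₂` a pre-step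
  have hθ'pre : IsPreStep (toElemZero hF hsq) θ' := isPreStep_of_isIso (toElemZero hF hsq) θ'
  have hg : IsPreStep F f.num := isPreStep_num f (by rw [hf]; exact hθ'pre)
  have hε : IsPreStep F f.den := f.den_mem.2
  -- an auxiliary morphism of Frobenius type of degree `n` into the apex `E°`
  obtain ⟨P₀, γ₀, hγ₀, hd₀⟩ := (hperf f.src n).1 f.src ⟨Iso.refl _⟩
  -- base-isomorphisms for the hypotheses of perfection (b)
  haveI : IsIso (Base F γ₀) := hγ₀.2
  haveI : IsIso (Base F γ₁) := hγ₁.2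
  haveI : IsIso (Base F γ₂) := hγ₂.2
  haveI : IsIso (Base F f.den) := hε.2
  haveI : IsIso (Base F f.num) := hg.2
  have hb₁ : BaseIsomorphic F P₀ P₁ :=
    ⟨asIso (Base F γ₀) ≪≫ asIso (Base F f.den) ≪≫ (asIso (Base F γ₁)).symm⟩
  have hb₂ : BaseIsomorphic F P₀ P₂ :=
    ⟨asIso (Base F γ₀) ≪≫ asIso (Base F f.num) ≪≫ (asIso (Base F γ₂)).symm⟩
  -- lift `ε` and `g`
  obtain ⟨εt, ⟨hεt, hεt_eq⟩, -⟩ :=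
    (hperf P₀ n).2 γ₀ γ₁ ⟨Iso.refl _⟩ hb₁ hγ₀ hd₀ hγ₁ hd₁ f.den hε
  obtain ⟨gt, ⟨hgt, hgt_eq⟩, -⟩ :=
    (hperf P₀ n).2 γ₀ γ₂ ⟨Iso.refl _⟩ hb₂ hγ₀ hd₀ hγ₂ hd₂ f.num hg
  -- both lifts are co-angular pre-steps, hence invertible in `C^birat`
  haveI := toBirat_inverts hF hsq εt (isCoAngularPreStep_of_isotropic hiso hεt)
  haveI := toBirat_inverts hF hsq gt (isCoAngularPreStep_of_isotropic hiso hgt)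
  haveI := toBirat_inverts hF hsq f.den f.den_mem
  refine ⟨inv ((toBirat F hF hsq).map εt) ≫ (toBirat F hF hsq).map gt, inferInstance, ?_⟩
  -- the equation: `ε̃⁻¹ g̃ γ₂ = ε̃⁻¹ γ° g = γ₁ ε⁻¹ g = γ₁ θ′`
  have e₁ : (toBirat F hF hsq).map εt ≫ (toBirat F hF hsq).map γ₁ =
      (toBirat F hF hsq).map γ₀ ≫ (toBirat F hF hsq).map f.den := by
    rw [← Functor.map_comp, hεt_eq, Functor.map_comp]
  have e₂ : (toBirat F hF hsq).map gt ≫ (toBirat F hF hsq).map γ₂ =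
      (toBirat F hF hsq).map γ₀ ≫ (toBirat F hF hsq).map f.num := by
    rw [← Functor.map_comp, hgt_eq, Functor.map_comp]
  rw [← hf, homMk_eq_inv_comp f, Category.assoc, e₂, ← Category.assoc, ← Category.assoc]
  congr 1
  rw [IsIso.inv_comp_eq, ← Category.assoc, IsIso.eq_comp_inv, e₁]

/-- **Cancellation of Frobenius-type images against isomorphisms.** For `C` a Frobenioid of perfect
type, `γ : P → E` of Frobenius type and isomorphisms `u, v : W ⥲ P^birat` of `C^birat`
with `u ≫ γ^birat = v ≫ γ^birat`, one has `u = v`.  Proof: `w := v⁻¹ u = [(δ, δ′)]` is an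
automorphism of `P^birat` with `δ, δ′` pre-steps and `w ≫ γ^birat = γ^birat`, i.e.
`(δ′ ≫ γ)^birat = (δ ≫ γ)^birat`, so `δ′ ≫ γ = δ ≫ γ` (Prop. 4.4 (ii), faithfulness); factor
`δ ≫ γ = γ′ ≫ β′` (Frobenius type ∘ pre-step, Prop. 1.7 (ii)) and apply the uniqueness half of
perfection (b) of `C` to conclude `δ = δ′`, i.e. `w = id`. [cite: MochizukiFrdI2008, Prop. 4.8 (ii) p.88] -/
theorem eq_of_comp_toBirat_map_eq (hperf : IsOfPerfectType F)
    {P E : C} (γ : P ⟶ E) (hγ : IsFrobeniusType F γ) {W : Birat F hF hsq}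
    (u v : W ⟶ (toBirat F hF hsq).obj P) [IsIso u] [IsIso v]
    (h : u ≫ (toBirat F hF hsq).map γ = v ≫ (toBirat F hF hsq).map γ) : u = v := by
  -- `w := v⁻¹ ≫ u`, an automorphism of `P^birat` fixing `γ^birat`
  obtain ⟨f, hf⟩ := exists_homMk_eq (inv v ≫ u)
  have hw : (homMk f : (toBirat F hF hsq).obj P ⟶ (toBirat F hF hsq).obj P) ≫
      (toBirat F hF hsq).map γ = (toBirat F hF hsq).map γ := by
    rw [hf, Category.assoc, h, IsIso.inv_hom_id_assoc]
  -- `δ′ := f.num` is a pre-step (`w` is an isomorphism), `δ := f.den` a co-angular pre-step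
  have hδ' : IsPreStep F f.num :=
    isPreStep_num f (by rw [hf]; exact isPreStep_of_isIso (toElemZero hF hsq) _)
  have hδ : IsPreStep F f.den := f.den_mem.2
  haveI := toBirat_inverts hF hsq f.den f.den_mem
  -- `δ′ ≫ γ = δ ≫ γ` in `C`, by faithfulness of `C → C^birat`
  have hC : f.num ≫ γ = f.den ≫ γ := by
    haveI := toBirat_faithful hF hsq
    apply (toBirat F hF hsq).map_injective
    rw [Functor.map_comp, Functor.map_comp, ← IsIso.inv_comp_eq, ← Category.assoc,
      ← homMk_eq_inv_comp f, hw]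
  -- factor `δ ≫ γ = γ′ ≫ β′`, `γ′` of Frobenius type (of degree `deg γ`), `β′` a pre-step
  have hbi : IsBaseIso F (f.den ≫ γ) := IsBaseIso.comp F hδ.2 hγ.2
  obtain ⟨X, γ', β', hfac, hγ', hβ'⟩ :=
    (isBaseIso_iff_exists_frobeniusType_preStep F hF (f.den ≫ γ)).mp hbi
  have hdeg : degFr F γ' = degFr F γ := by
    have e := degFr_comp F γ' β'
    rw [hfac, degFr_comp, show degFr F f.den = 1 from hδ.1, show degFr F β' = 1 from hβ'.1,
      one_mul, mul_one] at e
    exact e.symm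
  -- uniqueness half of perfection (b) of `C` at `f.src`
  haveI : IsIso (Base F f.den) := hδ.2
  have hb : BaseIsomorphic F f.src P := ⟨asIso (Base F f.den)⟩
  obtain ⟨ψ, -, huniq⟩ :=
    (hperf f.src (degFr F γ)).2 γ' γ ⟨Iso.refl _⟩ hb hγ' hdeg hγ rfl β' hβ'
  have h₁ : f.den = ψ := huniq f.den ⟨hδ, hfac.symm⟩
  have h₂ : f.num = ψ := huniq f.num ⟨hδ', by rw [hC, hfac]⟩
  -- hence `w = δ⁻¹ ≫ δ = id`
  have hw1 : (homMk f : (toBirat F hF hsq).obj P ⟶ (toBirat F hF hsq).obj P) =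
      𝟙 ((toBirat F hF hsq).obj P) := by
    rw [homMk_eq_inv_comp f, IsIso.inv_comp_eq, Category.comp_id, h₂, ← h₁]
  rw [← cancel_epi (inv v), IsIso.inv_hom_id, ← hf, hw1]

/-! ### Prop. 4.8 (ii) -/

/-- **Perfection (a) in `C^birat`**: every object `B^birat` admits, for every `n`, a morphism of
Frobenius type of degree `n` into it — the image of one in `C` (perfection (a) of `C`; Prop. 4.4 (iv)).
[cite: MochizukiFrdI2008, Prop. 4.8 (ii) p.88] -/
theorem exists_isFrobeniusType_to (hperf : IsOfPerfectType F) (hiso : IsOfIsotropicType F)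
    (Y : Birat F hF hsq) (n : ℕ+) :
    ∃ (Y₀ : Birat F hF hsq) (φ : Y₀ ⟶ Y),
      IsFrobeniusType (toElemZero hF hsq) φ ∧ degFr (toElemZero hF hsq) φ = n := by
  obtain ⟨B₀, φ, hφ, hd⟩ := (hperf Y.out n).1 Y.out ⟨Iso.refl _⟩
  exact ⟨(toBirat F hF hsq).obj B₀, (toBirat F hF hsq).map φ,
    (isFrobeniusType_iff_isBaseIso hiso _).mpr (isBaseIso_toElemZero_map hφ.2), hd⟩

/-- **Perfection (b) in `C^birat`** (unique lifting of pre-steps along pairs of morphisms of Frobenius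
type of equal degree), over objects `Aᵢ^birat`: write `φᵢ = αᵢ⁻¹ ∘ γᵢ ∘ βᵢ` with `αᵢ` a co-angular
pre-step, `γᵢ` of Frobenius type of degree `n`, `βᵢ` a pre-step (Prop. 1.7 (ii)); pre-steps of
`C^birat` are isomorphisms (Prop. 4.8 (i)), so existence is `exists_lift_iso` and uniqueness is
`eq_of_comp_toBirat_map_eq`. [cite: MochizukiFrdI2008, Prop. 4.8 (ii) p.88] -/
theorem existsUnique_lift (hperf : IsOfPerfectType F) (hiso : IsOfIsotropicType F) {n : ℕ+}
    {A₁ A₁' A₂ A₂' : C} (φ₁ : (toBirat F hF hsq).obj A₁ ⟶ (toBirat F hF hsq).obj A₁')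
    (φ₂ : (toBirat F hF hsq).obj A₂ ⟶ (toBirat F hF hsq).obj A₂')
    (hφ₁ : IsBaseIso (toElemZero hF hsq) φ₁) (hd₁ : degFr (toElemZero hF hsq) φ₁ = n)
    (hφ₂ : IsBaseIso (toElemZero hF hsq) φ₂) (hd₂ : degFr (toElemZero hF hsq) φ₂ = n)
    (ψ' : (toBirat F hF hsq).obj A₁' ⟶ (toBirat F hF hsq).obj A₂') (hψ' : IsIso ψ') :
    ∃! ψ : (toBirat F hF hsq).obj A₁ ⟶ (toBirat F hF hsq).obj A₂,
      IsPreStep (toElemZero hF hsq) ψ ∧ ψ ≫ φ₂ = φ₁ ≫ ψ' := by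
  obtain ⟨f₁, rfl⟩ := exists_homMk_eq φ₁
  obtain ⟨f₂, rfl⟩ := exists_homMk_eq φ₂
  -- numerators: base-isomorphisms of degree `n`, factored as Frobenius type ∘ pre-step
  have hn₁ : IsBaseIso F f₁.num := isBaseIso_num f₁ hφ₁
  have hn₂ : IsBaseIso F f₂.num := isBaseIso_num f₂ hφ₂
  obtain ⟨E₁, γ₁, β₁, hfac₁, hγ₁, hβ₁⟩ :=
    (isBaseIso_iff_exists_frobeniusType_preStep F hF f₁.num).mp hn₁
  obtain ⟨E₂, γ₂, β₂, hfac₂, hγ₂, hβ₂⟩ :=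
    (isBaseIso_iff_exists_frobeniusType_preStep F hF f₂.num).mp hn₂
  have hdγ₁ : degFr F γ₁ = n := by
    have e := degFr_comp F γ₁ β₁
    rw [hfac₁, show degFr F β₁ = 1 from hβ₁.1, mul_one] at e
    exact e.symm.trans hd₁
  have hdγ₂ : degFr F γ₂ = n := by
    have e := degFr_comp F γ₂ β₂
    rw [hfac₂, show degFr F β₂ = 1 from hβ₂.1, mul_one] at e
    exact e.symm.trans hd₂
  -- all the pre-steps involved are invertible in `C^birat`
  haveI := toBirat_inverts hF hsq f₁.den f₁.den_mem
  haveI := toBirat_inverts hF hsq f₂.den f₂.den_mem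
  haveI := toBirat_inverts hF hsq β₁ (isCoAngularPreStep_of_isotropic hiso hβ₁)
  haveI := toBirat_inverts hF hsq β₂ (isCoAngularPreStep_of_isotropic hiso hβ₂)
  -- `φᵢ = αᵢ⁻¹ ≫ γᵢ ≫ βᵢ` in `C^birat`
  have eφ₁ : (homMk f₁ : (toBirat F hF hsq).obj A₁ ⟶ (toBirat F hF hsq).obj A₁') =
      inv ((toBirat F hF hsq).map f₁.den) ≫ (toBirat F hF hsq).map γ₁ ≫
        (toBirat F hF hsq).map β₁ := by
    rw [homMk_eq_inv_comp f₁, ← Functor.map_comp, hfac₁]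
  have eφ₂ : (homMk f₂ : (toBirat F hF hsq).obj A₂ ⟶ (toBirat F hF hsq).obj A₂') =
      inv ((toBirat F hF hsq).map f₂.den) ≫ (toBirat F hF hsq).map γ₂ ≫
        (toBirat F hF hsq).map β₂ := by
    rw [homMk_eq_inv_comp f₂, ← Functor.map_comp, hfac₂]
  -- existence: lift `θ′ := β₁ ≫ ψ′ ≫ β₂⁻¹` along `(γ₁, γ₂)`
  obtain ⟨θ, hθ, hθ_eq⟩ := exists_lift_iso (hF := hF) (hsq := hsq) hperf hiso γ₁ γ₂ hγ₁ hdγ₁ hγ₂ hdγ₂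
    ((toBirat F hF hsq).map β₁ ≫ ψ' ≫ inv ((toBirat F hF hsq).map β₂))
  refine ⟨inv ((toBirat F hF hsq).map f₁.den) ≫ θ ≫ (toBirat F hF hsq).map f₂.den, ⟨?_, ?_⟩, ?_⟩
  · exact isPreStep_of_isIso (toElemZero hF hsq) _
  · rw [eφ₁, eφ₂]
    simp only [Category.assoc, IsIso.hom_inv_id_assoc]
    rw [reassoc_of% hθ_eq]
    simp only [IsIso.inv_hom_id, Category.comp_id]
  -- uniqueness
  · rintro ψ ⟨hψ, hψ_eq⟩
    haveI : IsIso ψ := isIso_of_isPreStep hiso ψ hψ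
    have key : (ψ ≫ inv ((toBirat F hF hsq).map f₂.den)) ≫ (toBirat F hF hsq).map γ₂ =
        ((inv ((toBirat F hF hsq).map f₁.den) ≫ θ ≫ (toBirat F hF hsq).map f₂.den) ≫
          inv ((toBirat F hF hsq).map f₂.den)) ≫ (toBirat F hF hsq).map γ₂ := by
      rw [← cancel_mono ((toBirat F hF hsq).map β₂)]
      simp only [Category.assoc, IsIso.hom_inv_id_assoc]
      rw [reassoc_of% hθ_eq]
      simp only [IsIso.inv_hom_id, Category.comp_id]
      have e := hψ_eq
      rw [eφ₂, eφ₁] at e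
      simpa only [Category.assoc] using e
    have := eq_of_comp_toBirat_map_eq (hF := hF) (hsq := hsq) hperf γ₂ hγ₂ _ _ key
    rw [← cancel_mono (inv ((toBirat F hF hsq).map f₂.den)), this]

/-- Every object of the birationalization of a Frobenioid of perfect and isotropic type is perfect
(Def. 1.2 (iv)). [cite: MochizukiFrdI2008, Prop. 4.8 (ii) p.88] -/
theorem isPerfectObj (hperf : IsOfPerfectType F) (hiso : IsOfIsotropicType F) (X : Birat F hF hsq) :
    IsPerfectObj (toElemZero hF hsq) X := by
  intro n
  refine ⟨fun Y _ => exists_isFrobeniusType_to hperf hiso Y n, ?_⟩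
  intro B₁ B₁' B₂ B₂' φ₁ φ₂ _ _ hφ₁ hd₁ hφ₂ hd₂ ψ' hψ'
  exact existsUnique_lift (A₁ := B₁.out) (A₁' := B₁'.out) (A₂ := B₂.out) (A₂' := B₂'.out)
    hperf hiso φ₁ φ₂ hφ₁.2 hd₁ hφ₂.2 hd₂ ψ' (isIso_of_isPreStep hiso ψ' hψ')

/-- **[FrdI] Proposition 4.8 (ii)** for THE birationalization: "If `C` is of perfect and isotropic
type, then so is `C^birat`" — perfect type of `C^birat → F_{0_D}` (isotropic type is
`Birat.isOfIsotropicType`). [cite: MochizukiFrdI2008, Prop. 4.8 (ii) p.88] -/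
theorem isOfPerfectType (hperf : IsOfPerfectType F) (hiso : IsOfIsotropicType F) :
    IsOfPerfectType (toElemZero hF hsq) :=
  fun X => isPerfectObj hperf hiso X

end Birat

end PreFrobenioid

namespace PreFrobenioidData

variable {D : Type u} [Category.{v} D] {Φ : Dᵒᵖ ⥤ CommMonCat.{w}}
  {C : Type u'} [Category.{v'} C] {F : C ⥤ ElemFrobenioid Φ}

/-- "Base-isomorphic" through the adapter (stated there as `B ~ A`) is found's `BaseIsomorphic F A B`.
[cite: MochizukiFrdI2008, Def. 1.2 (ii) p.21] -/
theorem ofFunctor_baseIsomorphic_comm (A B : C) :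
    (ofFunctor Φ F).BaseIsomorphic B A ↔ PreFrobenioid.BaseIsomorphic F A B :=
  ⟨fun ⟨e⟩ => ⟨e.symm⟩, fun ⟨e⟩ => ⟨e.symm⟩⟩

/-- "Perfect object" through the adapter `ofFunctor` is found's `IsPerfectObj` (the two renderings of
Def. 1.2 (iv) differ only in the bundling of "pre-step" and the orientation of "base-isomorphic").
[cite: MochizukiFrdI2008, Def. 1.2 (iv) p.23] -/
theorem ofFunctor_isPerfectObj (A : C) :
    (ofFunctor Φ F).IsPerfectObj A ↔ PreFrobenioid.IsPerfectObj F A := by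
  simp only [IsPerfectObj, PreFrobenioid.IsPerfectObj, ofFunctor_isFrobeniusType, ofFunctor_isPreStep,
    ofFunctor_baseIsomorphic_comm, ofFunctor_degFr]

/-- **[FrdI] Proposition 4.8 (ii)**, perfect-type half, through the §3–§4 statement interface.
[cite: MochizukiFrdI2008, Prop. 4.8 (ii) p.88] -/
theorem isOfPerfectType_ofFunctor_toElemZero (hF : PreFrobenioid.IsFrobenioid F)
    (hsq : PreFrobenioid.HasBiratSquares F) (hperf : (ofFunctor Φ F).IsOfPerfectType)
    (hiso : (ofFunctor Φ F).IsOfIsotropicType) :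
    (ofFunctor (zeroMonoid D) (PreFrobenioid.Birat.toElemZero hF hsq)).IsOfPerfectType := by
  refine ⟨fun X => (ofFunctor_isPerfectObj X).mpr ?_⟩
  exact PreFrobenioid.Birat.isOfPerfectType
    (fun A => (ofFunctor_isPerfectObj A).mp (hperf.obj A))
    (fun A => (ofFunctor_isIsotropic F A).mp (hiso.obj A)) X

/-- **[FrdI] Proposition 4.8 (ii)** through the §3–§4 statement interface: literally the body of
`Prop48ii` at the operations `ofFunctor 0_D (C^birat → F_{0_D})` of THE birationalization of a
Frobenioid of perfect and isotropic type. [cite: MochizukiFrdI2008, Prop. 4.8 (ii) p.88] -/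
theorem prop48ii_body_toElemZero (hF : PreFrobenioid.IsFrobenioid F)
    (hsq : PreFrobenioid.HasBiratSquares F) :
    (ofFunctor Φ F).IsOfPerfectType → (ofFunctor Φ F).IsOfIsotropicType →
      (ofFunctor (zeroMonoid D) (PreFrobenioid.Birat.toElemZero hF hsq)).IsOfPerfectType ∧
        (ofFunctor (zeroMonoid D) (PreFrobenioid.Birat.toElemZero hF hsq)).IsOfIsotropicType :=
  fun hperf hiso => ⟨isOfPerfectType_ofFunctor_toElemZero hF hsq hperf hiso,
    isOfIsotropicType_ofFunctor_toElemZero hF hsq hiso⟩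

end PreFrobenioidData

end Literature.AlgebraicGeometry.Frobenioids
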